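import Summits.QuantumFields.YangMills.Theorems.BalabanUVNodesN15CurvedGluingCubeSpeciesEntries
import HarnessLib

/-!
# Route «BalabanUVNodes» (cluster K4 «SpineRates»), Track-A DAG node N15 = NE2, BACKGROUND LAYER — THE SPECIES OF A DIRICHLET CUBE, III: THE PRINT-COMPATIBLE SMALLNESS — the Neumann step
# `N̂_□∘V̂(c̃, ã)` majorised by BULK letters plus a BOUNDARY LETTER of the flat cube resolvent (`N_□∘M_{1_∂}, ∇^±N_□∘M_{1_∂} ≤ β_∂e^{−δd}`, in print `β_∂ = O(ηβ)`), and the cube propagator's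
# entries 0∕1 at a live background under `(βR_b + β_∂R_∂)c_r < 1`

Cell `pub-ymgap`, seat `pub-ymgap-dag-n15-w3` (WIDTH SEAT 3∕3 on node N15, director-ym №197 ∕ HUMAN RULING D-0149; plan `W-SEAT-START-LIST.md` §n15 item 3 — eighteenth piece; answers the
REGIME CAVEAT of files 16–17).  `bears_on: R4∕N15 · K3⁷ SpineGivenEndpointR13SepCoPH (stmt-QuantumFields-20544)`.  Filed `--supports stmt-QuantumFields-20544 --as helper` — COUNT-NEUTRAL.  Two
plumbing `def`s (`cmprCb`, `cmprCd`: the bulk and the boundary part of file 16's compressed zeroth-order coefficient, `cmprC = cmprCb + cmprCd` by `rfl`), the rest theorems; 0 `sorry`.  Imports BY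
NAME file 17 `…N15CurvedGluingCubeSpeciesEntries` (files 16∕13∕12; dag-n15-c FILES 45–48, `…BackgroundDressedInverse`; M1, B1a, B2; lit `B9SectDWeightedNeumann.neumann_majorant_wrow`∕`wrow_of_exp`,
n15-b `isUnit_one_sub_toMatrix'`, `rowSum_step`, `hasMaj_stepV`, `exists_const_hasMaj_ofBlocks`); nothing in the tree is modified.

WHY.  File 16 bounded the Neumann step of the dressed cube pair CRUDELY, `N̂_□V̂(c̃, ã) ≤ β·R·e^{−δd}` with `R ∋ 2|J|c_χr_a`, and for dag-n15-c's SHARP cut-off `c_χ = |∇^±χ| = η⁻¹` on the cube's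
boundary layer — so `βRc_r < 1` is not the print's regime.  In print ([Balaban1985BackgroundPropagators] p. 399, «expanding with respect to A» on cubes with Dirichlet conditions,
[Balaban1984PropagatorsII] pp. 230–231) the boundary term `c̃_∂ = Σ_μ χ(∇⁺_μχ·a⁺_μ + ∇⁻_μχ·a⁻_μ)` of the compressed zeroth-order coefficient is harmless because it is supported on a layer of
width ONE SPACING, which the flat cube resolvent integrates with weight `η`: `N_□∘M_{1_∂} = O(η)·e^{−δd}`.  THIS FILE displays exactly that as a BOUNDARY LETTER `β_∂` (`N_□∘M_ψ, ∇^±N_□∘M_ψ ≤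
β_∂e^{−δd}` for a cut-off `ψ` with `c̃_∂ = ψ·c̃_∂`) next to the bulk letters, bounds the STEP by `(βR_b + β_∂R_∂)e^{−δd}` with `R_b = (r_c + r_a)(1 + |J ⊕ J|)` (bulk: `c̃_b = χ²c`, `ã`) and `R_∂ =
2|J|c_χr_a(1 + |J ⊕ J|)` (boundary), runs B1a's Neumann series FROM THE STEP MAJORANT (a variant of `hasMaj_bgPropV` with the step given — lit `neumann_majorant_wrow` verbatim), and re-reads
files 16–17's entries 0∕1 and their by-name forms at `Δ_U + W` under the ONE smallness `(βR_b + β_∂R_∂)c_r < 1` — print-compatible: `β_∂c_χ = O(β)`, so the condition is `O(β(r_c + r_a)c_r) < 1`,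
i.e. (3.35)'s `α₁` small.

* §1 ★ `isUnit_of_step`, ★★ `hasMaj_bgPropV_of_step` (B1a's unit and Neumann-with-decay from a GIVEN step majorant `Ĝ∘V̂ ≤ qe^{−δd}`, `qc_r < 1`);
* §2 defs `cmprCb`, `cmprCd`, `cmprC_eq_add` (rfl); `rowSum_cmprCb_le`, `rowSum_cmprCd_le`; `unstackM_add_left`, `stack_comp`, `mmulOp_eq_mulOp_comp_of_support` (`M_{c̃_∂} = M_ψ∘M_{c̃_∂}` when
  `∇^±χ` vanish off `{ψ = 1}`), ★★ `hasMaj_step_cmpr_bdry` (the step `≤ (βR_b + β_∂R_∂)e^{−δd}`), ★★ `hasMaj_bgPairM_cmpr_bdry` (unit ∧ pair majorant `β(1 − qc_r)⁻¹e^{−ρd}`);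
* the cube propagator's entries from this pair majorant and their by-name forms at `Δ_U + W` = the companion file `…CurvedGluingCubeSpeciesBoundaryRows` (400-line rule).

HONEST FRAMING ∕ LIMITS.  Finite-dimensional algebra + B1a∕lit Neumann series over DISPLAYED letters: the flat cube resolvent's bulk entries `β` AND boundary entries `β_∂` (the thin-layer
gain `β_∂ = O(ηβ)` is the flat cube objects' business — dag-n15-a N-programme ∕ dag-n15-e King model — and is NOT proved here), the transport rows, the cut-off letters, the unit of
`dirOp`; ONE grid (two-grid defects: file 16's caveat stands); right entries not here; nothing of [B6]∕[B9] asserted ((2.133), (3.62)–(3.65), pp. 230–231, p. 399 = SHAPES ∕ MECHANISM).  NE2⁺ NOT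
PRINTED, NOT proved; N15 NOT discharged; counts of record UNMOVED (typed 28∕28 · discharged 5∕27); one finite 𝕋⁴ at fixed ε — NOT infinite volume, NOT OS on ℝ⁴, NOT a mass gap, NOT Clay; R4
closes the conditional finite-𝕋⁴ rung `BalabanLadder.UV` only.  Restate-immune (no Theses import).
-/

set_option autoImplicit false

noncomputable section
open scoped BigOperators
open Finset

namespace Summit.QuantumFields.YangMills.BalabanUVNodes.N15.CurvedSpecies

open Literature.MathematicalPhysics.QuantumFieldTheory.Balaban1983to89
open Literature.MathematicalPhysics.QuantumFieldTheory.Balaban1983to89.B11SectG (BlockNorm HasMaj RowSum)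
open Literature.MathematicalPhysics.QuantumFieldTheory.Balaban1983to89.B9SectDWeightedNeumann (WRow wrow_of_exp neumann_majorant_wrow)
open Literature.MathematicalPhysics.QuantumFieldTheory.Balaban1983to89.T4EtaRateCoeffDefect (diagK diagK_nonneg hasMaj_mulOp)
open Literature.MathematicalPhysics.QuantumFieldTheory.Balaban1983to89.B6RandomWalk (Triangle254)
open Literature.MathematicalPhysics.QuantumFieldTheory.Balaban1983to89.B6Prop26Gluing (mulOp mulOp_apply ind ind_nonneg)
open Summit.QuantumFields.YangMills.BalabanUVNodes.N15.MatrixSpecies (mmulOp mmulOp_apply liftBlk liftEquiv liftEquiv_apply liftEquiv_symm_apply hasMaj_mmulOp)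
open Summit.QuantumFields.YangMills.BalabanUVNodes.N15.BackgroundLayer (fgrad bgrad fgrad_apply bgrad_apply speciesOpM mmulOp_add stack projO blkPair hasMaj_stack hasMaj_projO_comp unstackM bgPairM
  bgPropV bgPropV_fix hasMaj_unstackM hasMaj_stepV isUnit_one_sub_toMatrix' rowSum_step covLapM tCoefA tCoefC)
open Summit.QuantumFields.YangMills.BalabanUVNodes.N15.BackgroundModel (kappa_ofBlocks)
open Summit.QuantumFields.YangMills.BalabanUVNodes.N15.DerivDefect (exists_const_hasMaj_ofBlocks)
open Summit.QuantumFields.YangMills.BalabanUVNodes.N15.Gluing (dirOp cubeInv lapOp mulOp_idem hasMaj_localize sandwich_in_out hasMaj_localize_sandwich hasMaj_diag_comp hasMaj_comp_diag)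

/-! ## §1 B1a's Neumann series from a given step majorant -/

section Step

variable {X X₂ : Type} [Fintype X] [Fintype X₂] [DecidableEq X] [DecidableEq X₂] {g : B6.Geometry} (blk : X → g.Site) (blk₂ : X₂ → g.Site)
  {G : (X → ℝ) →ₗ[ℝ] (X₂ → ℝ)} {V : (X₂ → ℝ) →ₗ[ℝ] (X → ℝ)} {β δ q σ cr : ℝ}

omit [Fintype X] [DecidableEq X] in
/-- ★ `1 − [Ĝ∘V̂]` IS A UNIT from a step majorant `Ĝ∘V̂ ≤ qe^{−δd}` with `qc_r < 1` (n15-b `isUnit_one_sub_toMatrix'`). [cite: Balaban1985BackgroundPropagators, (3.63)–(3.64) pp.402–403 (mechanism)] -/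
theorem isUnit_of_step (hd : ∀ a b : g.Site, 0 ≤ g.dist a b) (hrow : RowSum g σ cr) (hσδ : σ ≤ δ) (hq0 : 0 ≤ q)
    (hK : HasMaj (BlockNorm.ofBlocks g blk₂) (BlockNorm.ofBlocks g blk₂) (G ∘ₗ V) (fun y y' => q * Real.exp (-(δ * g.dist y y')))) (hq : q * cr < 1) :
    IsUnit (1 - LinearMap.toMatrix' (G ∘ₗ V)) := by
  refine isUnit_one_sub_toMatrix' hK (fun _ _ => mul_nonneg hq0 (Real.exp_nonneg _)) (fun y => ?_) hq
  simpa only [mul_one] using rowSum_step hd hrow hσδ hq0 zero_le_one y (β := q) (r := 1)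

/-- ★★ **NEUMANN WITH DECAY FROM A GIVEN STEP MAJORANT**: `Ĝ ≤ βe^{−δd}`, `Ĝ∘V̂ ≤ qe^{−δd}`, `qc_r < 1`, `0 ≤ ρ`, `ρ + σ ≤ δ` ⟹ `X(V̂) = (1 − ĜV̂)⁻¹Ĝ ≤ β(1 − qc_r)⁻¹e^{−ρd}` — B1a `hasMaj_bgPropV`
with the step supplied instead of computed from a diagonal letter (lit `neumann_majorant_wrow` verbatim). [cite: Balaban1985BackgroundPropagators, (3.64) p.403 (mechanism); Balaban1984PropagatorsII, (2.52)–(2.56) pp.232–233, (2.61) p.234] -/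
theorem hasMaj_bgPropV_of_step (htri : Triangle254 g) (hd : ∀ a b : g.Site, 0 ≤ g.dist a b) (hrow : RowSum g σ cr) (hσ : 0 ≤ σ) {ρ : ℝ} (hρ : 0 ≤ ρ) (hρδ : ρ + σ ≤ δ)
    (hβ : 0 ≤ β) (hq0 : 0 ≤ q) (hG : HasMaj (BlockNorm.ofBlocks g blk) (BlockNorm.ofBlocks g blk₂) G (fun y y' => β * Real.exp (-(δ * g.dist y y'))))
    (hK : HasMaj (BlockNorm.ofBlocks g blk₂) (BlockNorm.ofBlocks g blk₂) (G ∘ₗ V) (fun y y' => q * Real.exp (-(δ * g.dist y y')))) (hq : q * cr < 1) :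
    HasMaj (BlockNorm.ofBlocks g blk) (BlockNorm.ofBlocks g blk₂) (bgPropV G V) (fun y y' => β * (1 - q * cr)⁻¹ * Real.exp (-(ρ * g.dist y y'))) := by
  have hσδ : σ ≤ δ := by linarith
  have hfix := bgPropV_fix (isUnit_of_step blk₂ hd hrow hσδ hq0 hK hq)
  have hwrow : WRow g ρ (fun y y' => q * Real.exp (-(δ * g.dist y y'))) (q * cr) := wrow_of_exp hd hrow hq0 hρδ
  have hS : HasMaj (BlockNorm.ofBlocks g blk) (BlockNorm.ofBlocks g blk₂) G (fun y y' => β * Real.exp (-(ρ * g.dist y y'))) :=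
    hG.mono fun a b => mul_le_mul_of_nonneg_left (Real.exp_le_exp.mpr (by nlinarith [hd a b])) hβ
  obtain ⟨M₀, hM₀, hap⟩ := exists_const_hasMaj_ofBlocks (g := g) blk blk₂ (bgPropV G V)
  have hq1 : (BlockNorm.ofBlocks g blk₂).κ * (q * cr) < 1 := by rw [kappa_ofBlocks, one_mul]; exact hq
  have key := neumann_majorant_wrow htri hd hρ (fun _ _ => mul_nonneg hq0 (Real.exp_nonneg _)) hwrow hβ hM₀ hK hS hfix hap hq1
  refine key.mono fun a b => le_of_eq ?_
  rw [kappa_ofBlocks, one_mul]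

end Step

/-! ## §2 The step of the cube device: bulk letters plus a boundary letter -/

section Boundary

variable {X ι J : Type} [Fintype ι] [Fintype J] (τ : J → X ≃ X) (n : ℝ) (χX : X → ℝ) (C : X → Matrix ι ι ℝ) (A : J ⊕ J → X → Matrix ι ι ℝ)

/-- THE BULK PART `c̃_b = χ²c` of the compressed zeroth-order coefficient. [cite: Balaban1985BackgroundPropagators, (3.52) p.400 (c: shape)] -/
def cmprCb : X → Matrix ι ι ℝ := fun x => (χX x * χX x) • C x

/-- THE BOUNDARY PART `c̃_∂ = Σ_μ χ(∇⁺_μχ·a⁺_μ + ∇⁻_μχ·a⁻_μ)` — supported where the cut-off's quotients do not vanish (the one-spacing boundary layer of the cube).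
[cite: Balaban1984PropagatorsII, pp.230–231 (restriction to cubes: shape); Balaban1984PropagatorsI, (1.2)–(1.3) p.18 (shape)] -/
def cmprCd : X → Matrix ι ι ℝ := ∑ μ, ((fun x => (χX x * fgrad n (τ μ) χX x) • A (Sum.inl μ) x) + fun x => (χX x * bgrad n (τ μ) χX x) • A (Sum.inr μ) x)

omit [Fintype ι] in
/-- `c̃ = c̃_b + c̃_∂`. [folklore] -/
theorem cmprC_eq_add : cmprC τ n χX C A = cmprCb χX C + cmprCd τ n χX A := rfl

omit [Fintype ι] in
/-- Unfolding of `c̃_∂` at a point. [folklore] -/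
theorem cmprCd_apply (x : X) : cmprCd τ n χX A x = ∑ μ, ((χX x * fgrad n (τ μ) χX x) • A (Sum.inl μ) x + (χX x * bgrad n (τ μ) χX x) • A (Sum.inr μ) x) := by
  simp only [cmprCd, Finset.sum_apply, Pi.add_apply]

omit [Fintype J] in
/-- Bulk rows: `Σ_k|c̃_b(x)_{ik}| ≤ r_c`. [cite: Balaban1985BackgroundPropagators, (3.35) p.396 (shape)] -/
theorem rowSum_cmprCb_le {rC : ℝ} (hχ : ∀ x, |χX x| ≤ 1) (hC : ∀ x i, ∑ k, |C x i k| ≤ rC) (x : X) (i : ι) : ∑ k, |cmprCb χX C x i k| ≤ rC := by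
  simpa only [cmprCb, one_mul] using sum_abs_smul_row_le zero_le_one (abs_mul_le_one_of_le hχ x x) i (hC x i)

/-- Boundary rows: `Σ_k|c̃_∂(x)_{ik}| ≤ |J|·2c_χr_a`. [cite: Balaban1984PropagatorsII, p.229 (the cut-off's quotient as a letter: shape)] -/
theorem rowSum_cmprCd_le {rA cχ : ℝ} (hcχ : 0 ≤ cχ) (hχ : ∀ x, |χX x| ≤ 1) (hdχ : ∀ μ x, |fgrad n (τ μ) χX x| ≤ cχ) (hdχb : ∀ μ x, |bgrad n (τ μ) χX x| ≤ cχ)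
    (hA : ∀ j x i, ∑ k, |A j x i k| ≤ rA) (x : X) (i : ι) : ∑ k, |cmprCd τ n χX A x i k| ≤ Fintype.card J * (2 * (cχ * rA)) := by
  have hw1 : ∀ μ, |χX x * fgrad n (τ μ) χX x| ≤ cχ := fun μ => by
    rw [abs_mul]
    calc |χX x| * |fgrad n (τ μ) χX x| ≤ 1 * cχ := mul_le_mul (hχ x) (hdχ μ x) (abs_nonneg _) zero_le_one
      _ = cχ := one_mul cχ
  have hw2 : ∀ μ, |χX x * bgrad n (τ μ) χX x| ≤ cχ := fun μ => by
    rw [abs_mul]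
    calc |χX x| * |bgrad n (τ μ) χX x| ≤ 1 * cχ := mul_le_mul (hχ x) (hdχb μ x) (abs_nonneg _) zero_le_one
      _ = cχ := one_mul cχ
  have hμ : ∀ μ, ∑ k, |(((χX x * fgrad n (τ μ) χX x) • A (Sum.inl μ) x) + ((χX x * bgrad n (τ μ) χX x) • A (Sum.inr μ) x)) i k| ≤ 2 * (cχ * rA) := fun μ => by
    calc ∑ k, |(((χX x * fgrad n (τ μ) χX x) • A (Sum.inl μ) x) + ((χX x * bgrad n (τ μ) χX x) • A (Sum.inr μ) x)) i k|
        ≤ ∑ k, (|((χX x * fgrad n (τ μ) χX x) • A (Sum.inl μ) x) i k| + |((χX x * bgrad n (τ μ) χX x) • A (Sum.inr μ) x) i k|) :=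
          Finset.sum_le_sum fun k _ => by rw [Matrix.add_apply]; exact abs_add_le _ _
      _ ≤ cχ * rA + cχ * rA := by
          rw [Finset.sum_add_distrib]
          exact add_le_add (sum_abs_smul_row_le hcχ (hw1 μ) i (hA _ x i)) (sum_abs_smul_row_le hcχ (hw2 μ) i (hA _ x i))
      _ = 2 * (cχ * rA) := by ring
  have hsa : ∀ k, |(∑ μ, (((χX x * fgrad n (τ μ) χX x) • A (Sum.inl μ) x) + ((χX x * bgrad n (τ μ) χX x) • A (Sum.inr μ) x))) i k| ≤
      ∑ μ, |(((χX x * fgrad n (τ μ) χX x) • A (Sum.inl μ) x) + ((χX x * bgrad n (τ μ) χX x) • A (Sum.inr μ) x)) i k| := fun k => by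
    rw [Matrix.sum_apply]
    exact Finset.abs_sum_le_sum_abs _ _
  calc ∑ k, |cmprCd τ n χX A x i k| = ∑ k, |(∑ μ, (((χX x * fgrad n (τ μ) χX x) • A (Sum.inl μ) x) + ((χX x * bgrad n (τ μ) χX x) • A (Sum.inr μ) x))) i k| :=
        Finset.sum_congr rfl fun k _ => by rw [cmprCd_apply]
    _ ≤ ∑ k, ∑ μ, |(((χX x * fgrad n (τ μ) χX x) • A (Sum.inl μ) x) + ((χX x * bgrad n (τ μ) χX x) • A (Sum.inr μ) x)) i k| := Finset.sum_le_sum fun k _ => hsa k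
    _ = ∑ μ, ∑ k, |(((χX x * fgrad n (τ μ) χX x) • A (Sum.inl μ) x) + ((χX x * bgrad n (τ μ) χX x) • A (Sum.inr μ) x)) i k| := Finset.sum_comm
    _ ≤ ∑ _μ : J, 2 * (cχ * rA) := Finset.sum_le_sum fun μ _ => hμ μ
    _ = Fintype.card J * (2 * (cχ * rA)) := by rw [Finset.sum_const, Finset.card_univ, nsmul_eq_mul]

omit [Fintype J] in
/-- THE BOUNDARY COEFFICIENT IS CARRIED BY THE BOUNDARY CUT-OFF: if the cut-off's quotients vanish off `{ψ = 1}` then `M_{c̃_∂} = M_ψ∘M_{c̃_∂}`. [folklore] -/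
theorem mmulOp_cmprCd_eq_mulOp_comp [Fintype J] (ψ : X → ℝ) (hψ : ∀ μ x, ψ x ≠ 1 → fgrad n (τ μ) χX x = 0 ∧ bgrad n (τ μ) χX x = 0) :
    mmulOp (cmprCd τ n χX A) = mulOp (fun p : X × ι => ψ p.1) ∘ₗ mmulOp (cmprCd τ n χX A) := by
  refine LinearMap.ext fun f => funext fun p => ?_
  rw [LinearMap.comp_apply, mulOp_apply]
  by_cases h : ψ p.1 = 1
  · rw [h, one_mul]
  · have h0 : cmprCd τ n χX A p.1 = 0 := by
      rw [cmprCd_apply]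
      exact Finset.sum_eq_zero fun μ _ => by rw [(hψ μ p.1 h).1, (hψ μ p.1 h).2, mul_zero, zero_smul, zero_smul, add_zero]
    simp only [mmulOp_apply, h0, Matrix.zero_apply, zero_mul, Finset.sum_const_zero, mul_zero]

variable {F : Type} [AddCommGroup F] [Module ℝ F]

omit [Fintype J] in
/-- `unstackM` is additive in the zeroth-order coefficient: `V̂(c₁ + c₂, a) = V̂(c₁, a) + M_{c₂}∘pr₀`. [folklore] -/
theorem unstackM_add_left [Fintype J] (C₁ C₂ : X → Matrix ι ι ℝ) (A' : J ⊕ J → X → Matrix ι ι ℝ) :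
    unstackM (C₁ + C₂) A' = unstackM C₁ A' + mmulOp C₂ ∘ₗ projO none := by
  rw [unstackM, unstackM, mmulOp_add, LinearMap.add_comp]
  abel

omit [Fintype ι] [Fintype J] in
/-- A right factor passes inside the stack: `stack(G, D)∘T = stack(G∘T, D∘T)`. [folklore] -/
theorem stack_comp {Y K : Type} (G : F →ₗ[ℝ] (Y → ℝ)) (D : K → F →ₗ[ℝ] (Y → ℝ)) (T : F →ₗ[ℝ] F) :
    stack G D ∘ₗ T = stack (G ∘ₗ T) (fun j => D j ∘ₗ T) := by
  refine LinearMap.ext fun v => funext fun p => ?_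
  rcases p with ⟨y, _ | j⟩ <;> rfl

omit [Fintype ι] [Fintype J] in
/-- `unstackM c 0 = M_c∘pr₀`. [folklore] -/
theorem unstackM_zero_right [Fintype ι] [Fintype J] (C' : X → Matrix ι ι ℝ) : unstackM C' (fun _ : J ⊕ J => (0 : X → Matrix ι ι ℝ)) = mmulOp C' ∘ₗ projO none := by
  have h0 : mmulOp (0 : X → Matrix ι ι ℝ) = (0 : (X × ι → ℝ) →ₗ[ℝ] (X × ι → ℝ)) :=
    LinearMap.ext fun f => funext fun p => by simp only [mmulOp_apply, Pi.zero_apply, Matrix.zero_apply, zero_mul, Finset.sum_const_zero, LinearMap.zero_apply]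
  rw [unstackM, h0]
  simp only [LinearMap.zero_comp, Finset.sum_const_zero, add_zero]

variable [Fintype X] [DecidableEq X] [DecidableEq ι] [DecidableEq J] {g : B6.Geometry} (blk : X → g.Site) (Δ : (X × ι → ℝ) →ₗ[ℝ] (X × ι → ℝ)) (ψ : X → ℝ) {σ cr : ℝ}

omit [DecidableEq J] in
/-- ★★ **THE STEP OF THE CUBE DEVICE, BULK + BOUNDARY**: with the flat cube resolvent's bulk entries `N_□, ∇^±N_□ ≤ βe^{−δd}`, its BOUNDARY entries behind the boundary cut-off
`N_□∘M_ψ, ∇^±N_□∘M_ψ ≤ β_∂e^{−δd}` (`c̃_∂` carried by `ψ`), bulk rows `r_c, r_a` and boundary rows `|J|·2c_χr_a`: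
`N̂_□∘V̂(c̃, ã) ≤ (β·R_b + β_∂·R_∂)·e^{−δd}`, `R_b = (r_c + r_a)(1 + |J ⊕ J|)`, `R_∂ = |J|·2c_χr_a·(1 + |J ⊕ J|)`. [cite: Balaban1985BackgroundPropagators, (3.63) p.402 (shape), p.399; Balaban1984PropagatorsII, pp.230–231] -/
theorem hasMaj_step_cmpr_bdry {β βd rC rA cχ δ : ℝ} (hβ : 0 ≤ β) (hβd : 0 ≤ βd) (hrC : 0 ≤ rC) (hrA : 0 ≤ rA) (hcχ : 0 ≤ cχ) (hχ : ∀ x, |χX x| ≤ 1)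
    (hdχ : ∀ μ x, |fgrad n (τ μ) χX x| ≤ cχ) (hdχb : ∀ μ x, |bgrad n (τ μ) χX x| ≤ cχ) (hψ : ∀ μ x, ψ x ≠ 1 → fgrad n (τ μ) χX x = 0 ∧ bgrad n (τ μ) χX x = 0)
    (hC : ∀ x i, ∑ k, |C x i k| ≤ rC) (hA : ∀ j x i, ∑ k, |A j x i k| ≤ rA)
    (hN : HasMaj (BlockNorm.ofBlocks g (liftBlk blk ι)) (BlockNorm.ofBlocks g (liftBlk blk ι)) (cubeRes Δ (fun p : X × ι => χX p.1)) (fun y y' => β * Real.exp (-(δ * g.dist y y'))))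
    (hDN : ∀ μ, HasMaj (BlockNorm.ofBlocks g (liftBlk blk ι)) (BlockNorm.ofBlocks g (liftBlk blk ι)) (fgrad n (liftEquiv (τ μ) ι) ∘ₗ cubeRes Δ (fun p : X × ι => χX p.1))
      (fun y y' => β * Real.exp (-(δ * g.dist y y'))))
    (hDNb : ∀ μ, HasMaj (BlockNorm.ofBlocks g (liftBlk blk ι)) (BlockNorm.ofBlocks g (liftBlk blk ι)) (bgrad n (liftEquiv (τ μ) ι) ∘ₗ cubeRes Δ (fun p : X × ι => χX p.1))
      (fun y y' => β * Real.exp (-(δ * g.dist y y'))))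
    (hNd : HasMaj (BlockNorm.ofBlocks g (liftBlk blk ι)) (BlockNorm.ofBlocks g (liftBlk blk ι)) (cubeRes Δ (fun p : X × ι => χX p.1) ∘ₗ mulOp (fun p : X × ι => ψ p.1))
      (fun y y' => βd * Real.exp (-(δ * g.dist y y'))))
    (hDNd : ∀ μ, HasMaj (BlockNorm.ofBlocks g (liftBlk blk ι)) (BlockNorm.ofBlocks g (liftBlk blk ι))
      ((fgrad n (liftEquiv (τ μ) ι) ∘ₗ cubeRes Δ (fun p : X × ι => χX p.1)) ∘ₗ mulOp (fun p : X × ι => ψ p.1)) (fun y y' => βd * Real.exp (-(δ * g.dist y y'))))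
    (hDNbd : ∀ μ, HasMaj (BlockNorm.ofBlocks g (liftBlk blk ι)) (BlockNorm.ofBlocks g (liftBlk blk ι))
      ((bgrad n (liftEquiv (τ μ) ι) ∘ₗ cubeRes Δ (fun p : X × ι => χX p.1)) ∘ₗ mulOp (fun p : X × ι => ψ p.1)) (fun y y' => βd * Real.exp (-(δ * g.dist y y')))) :
    HasMaj (BlockNorm.ofBlocks g (blkPair (liftBlk blk ι))) (BlockNorm.ofBlocks g (blkPair (liftBlk blk ι)))
      (stack (cubeRes Δ (fun p : X × ι => χX p.1))
          (Sum.elim (fun μ => fgrad n (liftEquiv (τ μ) ι) ∘ₗ cubeRes Δ (fun p : X × ι => χX p.1)) (fun μ => bgrad n (liftEquiv (τ μ) ι) ∘ₗ cubeRes Δ (fun p : X × ι => χX p.1))) ∘ₗ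
        unstackM (cmprC τ n χX C A) (cmprA τ χX A))
      (fun y y' => (β * ((rC + rA) * (1 + Fintype.card (J ⊕ J))) + βd * (Fintype.card J * (2 * (cχ * rA)) * (1 + Fintype.card (J ⊕ J)))) * Real.exp (-(δ * g.dist y y'))) := by
  have hRb : 0 ≤ rC + rA := by positivity
  have hRd : 0 ≤ Fintype.card J * (2 * (cχ * rA)) := by positivity
  -- bulk: the stack ≤ β, the bulk perturbation ≤ diagK((r_c + r_a)(1 + |J⊕J|))
  have hD : ∀ j, HasMaj (BlockNorm.ofBlocks g (liftBlk blk ι)) (BlockNorm.ofBlocks g (liftBlk blk ι))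
      (Sum.elim (fun μ => fgrad n (liftEquiv (τ μ) ι) ∘ₗ cubeRes Δ (fun p : X × ι => χX p.1)) (fun μ => bgrad n (liftEquiv (τ μ) ι) ∘ₗ cubeRes Δ (fun p : X × ι => χX p.1)) j)
      (fun y y' => β * Real.exp (-(δ * g.dist y y'))) := fun j => by
    cases j with
    | inl μ => exact hDN μ
    | inr μ => exact hDNb μ
  have hS := hasMaj_stack (liftBlk blk ι) (fun _ _ => mul_nonneg hβ (Real.exp_nonneg _)) hN hD
  have hCb : ∀ x i, ∑ k, |cmprCb χX C x i k| ≤ rC + rA := fun x i => (rowSum_cmprCb_le χX C hχ hC x i).trans (by linarith)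
  have hAb : ∀ j x i, ∑ k, |cmprA τ χX A j x i k| ≤ rC + rA := fun j x i => (rowSum_cmprA_le τ hχ hA j x i).trans (by linarith)
  have hVb := hasMaj_unstackM (g := g) blk (J := J ⊕ J) hRb hCb hAb
  have tb := hasMaj_stepV (liftBlk blk ι) (blkPair (liftBlk blk ι)) hβ hS hVb
  -- boundary: the stack behind `M_ψ` ≤ β_∂, the boundary perturbation ≤ diagK(|J|2c_χr_a(1 + |J⊕J|))
  have hDd : ∀ j, HasMaj (BlockNorm.ofBlocks g (liftBlk blk ι)) (BlockNorm.ofBlocks g (liftBlk blk ι))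
      ((fun j => Sum.elim (fun μ => fgrad n (liftEquiv (τ μ) ι) ∘ₗ cubeRes Δ (fun p : X × ι => χX p.1)) (fun μ => bgrad n (liftEquiv (τ μ) ι) ∘ₗ cubeRes Δ (fun p : X × ι => χX p.1)) j ∘ₗ
        mulOp (fun p : X × ι => ψ p.1)) j)
      (fun y y' => βd * Real.exp (-(δ * g.dist y y'))) := fun j => by
    cases j with
    | inl μ => exact hDNd μ
    | inr μ => exact hDNbd μ
  have hSd := hasMaj_stack (liftBlk blk ι) (fun _ _ => mul_nonneg hβd (Real.exp_nonneg _)) hNd hDd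
  have hCd : ∀ x i, ∑ k, |cmprCd τ n χX A x i k| ≤ Fintype.card J * (2 * (cχ * rA)) := fun x i => rowSum_cmprCd_le τ n χX A hcχ hχ hdχ hdχb hA x i
  have hAd : ∀ (j : J ⊕ J) (x : X) (i : ι), ∑ k, |(fun _ : J ⊕ J => (0 : X → Matrix ι ι ℝ)) j x i k| ≤ Fintype.card J * (2 * (cχ * rA)) := fun _ x i => by
    simp only [Pi.zero_apply, Matrix.zero_apply, abs_zero, Finset.sum_const_zero]
    exact hRd
  have hVd := hasMaj_unstackM (g := g) blk (J := J ⊕ J) hRd hCd hAd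
  have td := hasMaj_stepV (liftBlk blk ι) (blkPair (liftBlk blk ι)) hβd hSd hVd
  -- assemble
  have e2 : stack (cubeRes Δ (fun p : X × ι => χX p.1))
        (Sum.elim (fun μ => fgrad n (liftEquiv (τ μ) ι) ∘ₗ cubeRes Δ (fun p : X × ι => χX p.1)) (fun μ => bgrad n (liftEquiv (τ μ) ι) ∘ₗ cubeRes Δ (fun p : X × ι => χX p.1))) ∘ₗ
        (mmulOp (cmprCd τ n χX A) ∘ₗ projO (J := J ⊕ J) none) =
      (stack (cubeRes Δ (fun p : X × ι => χX p.1))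
          (Sum.elim (fun μ => fgrad n (liftEquiv (τ μ) ι) ∘ₗ cubeRes Δ (fun p : X × ι => χX p.1)) (fun μ => bgrad n (liftEquiv (τ μ) ι) ∘ₗ cubeRes Δ (fun p : X × ι => χX p.1))) ∘ₗ
          mulOp (fun p : X × ι => ψ p.1)) ∘ₗ (mmulOp (cmprCd τ n χX A) ∘ₗ projO (J := J ⊕ J) none) := by
    conv_lhs => rw [mmulOp_cmprCd_eq_mulOp_comp τ n χX A ψ hψ]
    simp only [LinearMap.comp_assoc]
  have e3 := stack_comp (cubeRes Δ (fun p : X × ι => χX p.1))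
    (Sum.elim (fun μ => fgrad n (liftEquiv (τ μ) ι) ∘ₗ cubeRes Δ (fun p : X × ι => χX p.1)) (fun μ => bgrad n (liftEquiv (τ μ) ι) ∘ₗ cubeRes Δ (fun p : X × ι => χX p.1)))
    (mulOp (fun p : X × ι => ψ p.1))
  have e4 := unstackM_zero_right (ι := ι) (J := J) (X := X) (cmprCd τ n χX A)
  rw [← e4] at e2
  rw [cmprC_eq_add, unstackM_add_left, ← e4, LinearMap.comp_add, e2, e3]
  refine (tb.add td).mono fun y y' => le_of_eq ?_
  ring

/-- ★★ **THE PAIR AROUND THE CUBE RESOLVENT UNDER THE PRINT-COMPATIBLE SMALLNESS**: with `q := βR_b + β_∂R_∂` and `qc_r < 1`, the Neumann unit holds and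
`X̂ ≤ β(1 − qc_r)⁻¹e^{−ρd}` (`0 ≤ ρ`, `ρ + σ ≤ δ`). [cite: Balaban1985BackgroundPropagators, (3.64) p.403 (mechanism); Balaban1984PropagatorsII, (2.52)–(2.56), (2.61)] -/
theorem hasMaj_bgPairM_cmpr_bdry (htri : Triangle254 g) (hd : ∀ a b : g.Site, 0 ≤ g.dist a b) (hrow : RowSum g σ cr) (hσ : 0 ≤ σ) {ρ δ β βd rC rA cχ : ℝ} (hρ : 0 ≤ ρ)
    (hρδ : ρ + σ ≤ δ) (hβ : 0 ≤ β) (hβd : 0 ≤ βd) (hrC : 0 ≤ rC) (hrA : 0 ≤ rA) (hcχ : 0 ≤ cχ) (hχ : ∀ x, |χX x| ≤ 1) (hdχ : ∀ μ x, |fgrad n (τ μ) χX x| ≤ cχ)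
    (hdχb : ∀ μ x, |bgrad n (τ μ) χX x| ≤ cχ) (hψ : ∀ μ x, ψ x ≠ 1 → fgrad n (τ μ) χX x = 0 ∧ bgrad n (τ μ) χX x = 0) (hC : ∀ x i, ∑ k, |C x i k| ≤ rC)
    (hA : ∀ j x i, ∑ k, |A j x i k| ≤ rA)
    (hN : HasMaj (BlockNorm.ofBlocks g (liftBlk blk ι)) (BlockNorm.ofBlocks g (liftBlk blk ι)) (cubeRes Δ (fun p : X × ι => χX p.1)) (fun y y' => β * Real.exp (-(δ * g.dist y y'))))
    (hDN : ∀ μ, HasMaj (BlockNorm.ofBlocks g (liftBlk blk ι)) (BlockNorm.ofBlocks g (liftBlk blk ι)) (fgrad n (liftEquiv (τ μ) ι) ∘ₗ cubeRes Δ (fun p : X × ι => χX p.1))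
      (fun y y' => β * Real.exp (-(δ * g.dist y y'))))
    (hDNb : ∀ μ, HasMaj (BlockNorm.ofBlocks g (liftBlk blk ι)) (BlockNorm.ofBlocks g (liftBlk blk ι)) (bgrad n (liftEquiv (τ μ) ι) ∘ₗ cubeRes Δ (fun p : X × ι => χX p.1))
      (fun y y' => β * Real.exp (-(δ * g.dist y y'))))
    (hNd : HasMaj (BlockNorm.ofBlocks g (liftBlk blk ι)) (BlockNorm.ofBlocks g (liftBlk blk ι)) (cubeRes Δ (fun p : X × ι => χX p.1) ∘ₗ mulOp (fun p : X × ι => ψ p.1))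
      (fun y y' => βd * Real.exp (-(δ * g.dist y y'))))
    (hDNd : ∀ μ, HasMaj (BlockNorm.ofBlocks g (liftBlk blk ι)) (BlockNorm.ofBlocks g (liftBlk blk ι))
      ((fgrad n (liftEquiv (τ μ) ι) ∘ₗ cubeRes Δ (fun p : X × ι => χX p.1)) ∘ₗ mulOp (fun p : X × ι => ψ p.1)) (fun y y' => βd * Real.exp (-(δ * g.dist y y'))))
    (hDNbd : ∀ μ, HasMaj (BlockNorm.ofBlocks g (liftBlk blk ι)) (BlockNorm.ofBlocks g (liftBlk blk ι))
      ((bgrad n (liftEquiv (τ μ) ι) ∘ₗ cubeRes Δ (fun p : X × ι => χX p.1)) ∘ₗ mulOp (fun p : X × ι => ψ p.1)) (fun y y' => βd * Real.exp (-(δ * g.dist y y'))))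
    (hq : (β * ((rC + rA) * (1 + Fintype.card (J ⊕ J))) + βd * (Fintype.card J * (2 * (cχ * rA)) * (1 + Fintype.card (J ⊕ J)))) * cr < 1) :
    IsUnit (1 - LinearMap.toMatrix' (stack (cubeRes Δ (fun p : X × ι => χX p.1))
        (Sum.elim (fun μ => fgrad n (liftEquiv (τ μ) ι) ∘ₗ cubeRes Δ (fun p : X × ι => χX p.1)) (fun μ => bgrad n (liftEquiv (τ μ) ι) ∘ₗ cubeRes Δ (fun p : X × ι => χX p.1))) ∘ₗ
        unstackM (cmprC τ n χX C A) (cmprA τ χX A))) ∧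
      HasMaj (BlockNorm.ofBlocks g (liftBlk blk ι)) (BlockNorm.ofBlocks g (blkPair (liftBlk blk ι)))
        (bgPairM (cubeRes Δ (fun p : X × ι => χX p.1))
          (Sum.elim (fun μ => fgrad n (liftEquiv (τ μ) ι) ∘ₗ cubeRes Δ (fun p : X × ι => χX p.1)) (fun μ => bgrad n (liftEquiv (τ μ) ι) ∘ₗ cubeRes Δ (fun p : X × ι => χX p.1)))
          (cmprC τ n χX C A) (cmprA τ χX A))
        (fun y y' => β * (1 - (β * ((rC + rA) * (1 + Fintype.card (J ⊕ J))) + βd * (Fintype.card J * (2 * (cχ * rA)) * (1 + Fintype.card (J ⊕ J)))) * cr)⁻¹ *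
          Real.exp (-(ρ * g.dist y y'))) := by
  have hK := hasMaj_step_cmpr_bdry τ n χX C A blk Δ ψ hβ hβd hrC hrA hcχ hχ hdχ hdχb hψ hC hA hN hDN hDNb hNd hDNd hDNbd
  have hq0 : 0 ≤ β * ((rC + rA) * (1 + Fintype.card (J ⊕ J))) + βd * (Fintype.card J * (2 * (cχ * rA)) * (1 + Fintype.card (J ⊕ J))) := by positivity
  have hD : ∀ j, HasMaj (BlockNorm.ofBlocks g (liftBlk blk ι)) (BlockNorm.ofBlocks g (liftBlk blk ι))
      (Sum.elim (fun μ => fgrad n (liftEquiv (τ μ) ι) ∘ₗ cubeRes Δ (fun p : X × ι => χX p.1)) (fun μ => bgrad n (liftEquiv (τ μ) ι) ∘ₗ cubeRes Δ (fun p : X × ι => χX p.1)) j)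
      (fun y y' => β * Real.exp (-(δ * g.dist y y'))) := fun j => by
    cases j with
    | inl μ => exact hDN μ
    | inr μ => exact hDNb μ
  have hS := hasMaj_stack (liftBlk blk ι) (fun _ _ => mul_nonneg hβ (Real.exp_nonneg _)) hN hD
  have hσδ : σ ≤ δ := by linarith
  exact ⟨isUnit_of_step (blkPair (liftBlk blk ι)) hd hrow hσδ hq0 hK hq,
    hasMaj_bgPropV_of_step (liftBlk blk ι) (blkPair (liftBlk blk ι)) htri hd hrow hσ hρ hρδ hβ hq0 hS hK hq⟩

end Boundary


end Summit.QuantumFields.YangMills.BalabanUVNodes.N15.CurvedSpecies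

end
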